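import Literature.MathematicalPhysics.KineticTheory.HarmonicChainFlux
import Mathlib.Analysis.Matrix.Spectrum
import Mathlib.Analysis.Matrix.PosDef

/-!
# Stub `stub_harmonicMember`, auxiliary file 1 — the harmonic flux coefficient is a finite Stieltjes sum

Line `cayley-pencil` of crux `StieltjesRepresentation` (route `ContactStieltjesMeasure`), harmonic calibration
`lam = β = 0`. For the pinned harmonic chain `pinnedChain ω₂ 0 0 γ` the flux coefficient has the closed form
(`fluxCoeff_eq`, Nakazawa / Roy–Dhar 2008 eq. (2.8))

`c_N = γ/(2(1+γ²)) · (r + r^{2N-2})/(1 + r^{2N-1})`, `r + r⁻¹ = 2 + λ`, `λ = ω₂γ²/(1+γ²)`.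

We prove (`fluxCoeff_eq_sum_atoms`) that for `N ≥ 2` there are `γ`-FREE nonnegative weights `c_k` and positions
`s_k`, `k < N - 1`, with

`c_N = γ · ∑_k c_k / (γ² + s_k²)` for every `γ > 0`.

Proof (resolvent form, no residues): with `n = N - 1` and the `γ`-free Jacobi matrix
`K = (-Δ_free on n sites) + E₀₀ = forceMatrix 0 n + indL ⊗ indL` (symmetric, positive semidefinite), the
explicit vector `x_j = r · u_j / (1 + r^{2n+1})`, `u_j = r^j + r^{2n-1-j}` (`useq`), solves
`(λ + K) x = e₀` and `x₀ = (r + r^{2n})/(1 + r^{2n+1})`; expanding in an orthonormal eigenbasis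
`K φ_k = a_k φ_k` (`Matrix.IsHermitian.eigenvectorBasis`) gives `x₀ = ∑_k ⟨φ_k, e₀⟩²/(λ + a_k)`, and
`1/((1+γ²)(λ + a_k)) = (ω₂ + a_k)⁻¹/(γ² + a_k/(ω₂ + a_k))`, so `c_k = ⟨φ_k,e₀⟩²/(2(ω₂+a_k))`,
`s_k = √(a_k/(ω₂+a_k))` (`a_k ≥ 0` by positive semidefiniteness).
-/

noncomputable section

open Matrix Finset
open Literature.MathematicalPhysics.KineticTheory.HeatConduction

namespace Summit.AtomisticToContinuum.FouriersLaw.Theorems.ContactStieltjesMeasure.CayleyPencil.HarmonicMember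

/-! ## A resolvent identity for real symmetric matrices -/

section Resolvent

variable {ι : Type*} [Fintype ι] [DecidableEq ι]

/-- Parseval's identity in an orthonormal eigenbasis of a real symmetric matrix, in `dotProduct` form:
`u ⬝ v = ∑_k (φ_k ⬝ u)(φ_k ⬝ v)`. -/
theorem dotProduct_eq_sum_eigenvectorBasis {K : Matrix ι ι ℝ} (hK : K.IsHermitian) (u v : ι → ℝ) :
    u ⬝ᵥ v = ∑ k, (⇑(hK.eigenvectorBasis k) ⬝ᵥ u) * (⇑(hK.eigenvectorBasis k) ⬝ᵥ v) := by
  have h := hK.eigenvectorBasis.sum_inner_mul_inner (WithLp.toLp 2 u) (WithLp.toLp 2 v)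
  simp only [EuclideanSpace.inner_eq_star_dotProduct, star_trivial] at h
  rw [dotProduct_comm u v, ← h]
  exact Finset.sum_congr rfl fun k _ => by rw [dotProduct_comm v]

/-- The eigen-coefficients of a solution of `(λ + K) x = e` for a real symmetric `K` with `K φ_k = a_k φ_k`:
`(λ + a_k) (φ_k ⬝ x) = φ_k ⬝ e`. -/
theorem eigenvalue_mul_dotProduct_of_resolvent {K : Matrix ι ι ℝ} (hK : K.IsHermitian) {lam : ℝ}
    {x e : ι → ℝ} (hx : lam • x + K *ᵥ x = e) (k : ι) :
    (lam + hK.eigenvalues k) * (⇑(hK.eigenvectorBasis k) ⬝ᵥ x) = ⇑(hK.eigenvectorBasis k) ⬝ᵥ e := by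
  have hKt : Kᵀ = K := by
    rw [← conjTranspose_eq_transpose_of_trivial]
    exact hK
  rw [← hx, dotProduct_add, dotProduct_smul, dotProduct_mulVec, ← mulVec_transpose, hKt,
    hK.mulVec_eigenvectorBasis k, smul_dotProduct, smul_eq_mul, smul_eq_mul]
  ring

/-- **Resolvent corner identity.** If `(λ + K) x = e` for a real symmetric `K` with orthonormal eigenbasis
`K φ_k = a_k φ_k` and `λ + a_k ≠ 0` for all `k`, then `e ⬝ x = ∑_k (φ_k ⬝ e)² / (λ + a_k)`. -/
theorem dotProduct_resolvent_eq_sum {K : Matrix ι ι ℝ} (hK : K.IsHermitian) {lam : ℝ}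
    {x e : ι → ℝ} (hx : lam • x + K *ᵥ x = e) (hne : ∀ k, lam + hK.eigenvalues k ≠ 0) :
    e ⬝ᵥ x = ∑ k, (⇑(hK.eigenvectorBasis k) ⬝ᵥ e) ^ 2 / (lam + hK.eigenvalues k) := by
  rw [dotProduct_eq_sum_eigenvectorBasis hK e x]
  refine Finset.sum_congr rfl fun k _ => ?_
  have h := eigenvalue_mul_dotProduct_of_resolvent hK hx k
  rw [eq_div_iff (hne k)]
  linear_combination (⇑(hK.eigenvectorBasis k) ⬝ᵥ e) * h

end Resolvent

/-! ## The Jacobi matrix `K_n = (-Δ_free) + E₀₀` and the explicit solution of `(λ + K_n) x = e₀` -/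

section Jacobi

variable {n : ℕ}

/-- `indL ⬝ u = u₀` (the corner functional). -/
theorem indL_dotProduct (hn : 0 < n) (u : Fin n → ℝ) : indL ⬝ᵥ u = u ⟨0, hn⟩ := by
  unfold dotProduct
  rw [Finset.sum_eq_single_of_mem (⟨0, hn⟩ : Fin n) (Finset.mem_univ _)]
  · rw [indL_of_eq rfl, one_mul]
  · intro j _ hj
    rw [indL_of_ne, zero_mul]
    intro h
    exact hj (Fin.ext h)

/-- `((u ⊗ v) w)_i = u_i (v ⬝ w)`. -/
theorem vecMulVec_mulVec_apply {m : Type*} [Fintype m] (u v w : m → ℝ) (i : m) :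
    (vecMulVec u v *ᵥ w) i = u i * (v ⬝ᵥ w) := by
  simp [mulVec, dotProduct, vecMulVec_apply, Finset.mul_sum, mul_assoc]

/-- The `γ`-free Jacobi matrix `K_n = forceMatrix 0 n + indL ⊗ indL` (tridiagonal, diagonal `(2,…,2,1)`,
off-diagonal `-1`) is symmetric. -/
theorem jacobi_isHermitian (n : ℕ) :
    (forceMatrix (0 : ℝ) n + vecMulVec indL indL).IsHermitian := by
  have h1 : (forceMatrix (0 : ℝ) n).IsHermitian := by
    rw [Matrix.IsHermitian, conjTranspose_eq_transpose_of_trivial, forceMatrix_transpose]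
  have h2 : (vecMulVec (indL : Fin n → ℝ) indL).IsHermitian := by
    have h := posSemidef_vecMulVec_self_star (indL : Fin n → ℝ)
    rw [star_trivial] at h
    exact h.1
  exact h1.add h2

/-- The Jacobi matrix `K_n` is positive semidefinite: `x ⬝ K_n x = ∑ (x_{k+1} - x_k)² + x₀² ≥ 0`. -/
theorem jacobi_posSemidef (n : ℕ) :
    (forceMatrix (0 : ℝ) n + vecMulVec indL indL).PosSemidef := by
  have h1 : (forceMatrix (0 : ℝ) n).PosSemidef := by
    refine PosSemidef.of_dotProduct_mulVec_nonneg ?_ fun x => ?_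
    · rw [Matrix.IsHermitian, conjTranspose_eq_transpose_of_trivial, forceMatrix_transpose]
    · rw [star_dotProduct_forceMatrix_mulVec]
      simp only [star_trivial, zero_mul, zero_add]
      exact Finset.sum_nonneg fun k _ => Finset.sum_nonneg fun l _ => by
        split_ifs
        · exact mul_self_nonneg _
        · exact le_rfl
  have h2 : (vecMulVec (indL : Fin n → ℝ) indL).PosSemidef := by
    have h := posSemidef_vecMulVec_self_star (indL : Fin n → ℝ)
    rwa [star_trivial] at h
  exact h1.add h2

/-- The action of `K_n`: `(K_n u)_a = [a ≥ 1](u_a - u_{a-1}) - [a+1 < n](u_{a+1} - u_a) + [a = 0] u₀`. -/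
theorem jacobi_mulVec_apply (hn : 0 < n) (u : Fin n → ℝ) (a : Fin n) :
    ((forceMatrix (0 : ℝ) n + vecMulVec indL indL) *ᵥ u) a =
      ((if h : 0 < a.val then u a - u ⟨a.val - 1, by omega⟩ else 0) -
        (if h : a.val + 1 < n then u ⟨a.val + 1, h⟩ - u a else 0)) + indL a * u ⟨0, hn⟩ := by
  rw [add_mulVec, Pi.add_apply, forceMatrix_mulVec_apply_eq, vecMulVec_mulVec_apply,
    indL_dotProduct hn, zero_mul, zero_add]

/-- **The explicit resolvent column.** For `ω₂, γ > 0`, `n ≥ 1`, `r = rootR ω₂ γ`, `λ = lamb ω₂ γ` and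
`u = useq ω₂ γ n` (`u_j = r^j + r^{2n-1-j}`), the vector `x_j = r u_j / (1 + r^{2n+1})` solves
`(λ + K_n) x = e₀ = indL`. -/
theorem jacobi_resolvent_solution {ω₂ γ : ℝ} (hω : 0 < ω₂) (hγ : 0 < γ) (hn : 0 < n) :
    lamb ω₂ γ • (fun j : Fin n => rootR ω₂ γ * useq ω₂ γ n j / (1 + rootR ω₂ γ ^ (2 * n + 1))) +
      (forceMatrix (0 : ℝ) n + vecMulVec indL indL) *ᵥ
        (fun j : Fin n => rootR ω₂ γ * useq ω₂ γ n j / (1 + rootR ω₂ γ ^ (2 * n + 1))) = indL := by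
  have hr := rootR_pos hω hγ
  have hr0 : rootR ω₂ γ ≠ 0 := hr.ne'
  have hq := rootR_quad hω hγ
  have hrec := useq_rec hω hγ n
  have hD : (1 + rootR ω₂ γ ^ (2 * n + 1)) ≠ 0 := by positivity
  funext a
  rw [Pi.add_apply, Pi.smul_apply, smul_eq_mul, jacobi_mulVec_apply hn]
  rcases a with ⟨_ | k, hk⟩
  · -- the corner row `a = 0`
    rw [dif_neg (lt_irrefl 0), indL_of_eq rfl, zero_sub, one_mul]
    by_cases h1 : 0 + 1 < n
    · rw [dif_pos h1]
      simp only [Nat.zero_add]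
      have e1 : rootR ω₂ γ ^ (2 * n + 1) = rootR ω₂ γ ^ (2 * n - 2) * rootR ω₂ γ ^ 3 := by
        rw [← pow_add]; congr 1; omega
      have e2 : rootR ω₂ γ ^ (2 * n - 1) = rootR ω₂ γ ^ (2 * n - 2) * rootR ω₂ γ := by
        rw [← pow_succ]; congr 1; omega
      have e3 : rootR ω₂ γ ^ (2 * n - 2) * rootR ω₂ γ * (rootR ω₂ γ)⁻¹ = rootR ω₂ γ ^ (2 * n - 2) := by
        rw [mul_assoc, mul_inv_cancel₀ hr0, mul_one]
      simp only [useq, pow_zero, pow_one, mul_one, e1, e2, e3]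
      field_simp
      linear_combination (-(1 + rootR ω₂ γ * rootR ω₂ γ ^ (2 * n - 2))) * hq
    · obtain rfl : n = 1 := by omega
      rw [dif_neg h1]
      simp only [useq, pow_zero, mul_one]
      norm_num
      field_simp
      linear_combination (-(1 + rootR ω₂ γ)) * hq
  · -- rows `a = k + 1 ≥ 1`
    rw [dif_pos (Nat.succ_pos k), indL_of_ne (Nat.succ_ne_zero k), zero_mul, add_zero]
    simp only [Nat.add_sub_cancel]
    by_cases h1 : k + 1 + 1 < n
    · rw [dif_pos h1]
      have hk2 := hrec k
      field_simp
      linear_combination (-rootR ω₂ γ) * hk2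
    · obtain rfl : n = k + 2 := by omega
      rw [dif_neg h1, sub_zero]
      have hk2 := hrec k
      have hsym := useq_symm hω hγ (k + 2) (k := k + 1) (by omega)
      rw [show 2 * (k + 2) - 1 - (k + 1) = k + 2 by omega] at hsym
      field_simp
      linear_combination rootR ω₂ γ * (hsym - hk2)

end Jacobi

/-! ## The flux coefficient as a Stieltjes sum of `N - 1` atoms -/

/-- The one-atom algebra: `γ/(2(1+γ²)) · w/(λ + a) = γ · (w/(2(ω₂+a))) / (γ² + a/(ω₂+a))` for
`λ = ω₂γ²/(1+γ²)`, `a ≥ 0`. -/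
theorem atom_algebra {ω₂ γ a : ℝ} (hω : 0 < ω₂) (hγ : 0 < γ) (ha : 0 ≤ a) (w : ℝ) :
    γ / (2 * (1 + γ ^ 2)) * (w / (lamb ω₂ γ + a)) =
      γ * ((w / (2 * (ω₂ + a))) / (γ ^ 2 + Real.sqrt (a / (ω₂ + a)) ^ 2)) := by
  rw [Real.sq_sqrt (by positivity)]
  have h1 : (1 + γ ^ 2) ≠ 0 := by positivity
  have h2 : ω₂ + a ≠ 0 := by positivity
  have h3 : ω₂ * γ ^ 2 / (1 + γ ^ 2) + a ≠ 0 := by positivity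
  have h3' : ω₂ * γ ^ 2 + a * (1 + γ ^ 2) ≠ 0 := by positivity
  have h4 : γ ^ 2 + a / (ω₂ + a) ≠ 0 := by positivity
  have h4' : γ ^ 2 * (ω₂ + a) + a ≠ 0 := by positivity
  unfold lamb
  field_simp
  ring

/-- **The harmonic flux coefficient is a finite Stieltjes sum with `γ`-free atoms.** For `ω₂ > 0` and `N ≥ 2`
there are nonnegative weights `c_k` and positions `s_k` (`k < N - 1`), independent of `γ`, such that
`fluxCoeff ω₂ γ N = γ ∑_k c_k/(γ² + s_k²)` for every `γ > 0`. (With `K_{N-1} φ_k = a_k φ_k` orthonormal: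
`c_k = ⟨φ_k, e₀⟩²/(2(ω₂ + a_k))`, `s_k = √(a_k/(ω₂ + a_k))`; explicitly `a_k = 4 sin²(θ_k/2)`,
`θ_k = (2k+1)π/(2N-1)`, not needed here.) -/
theorem fluxCoeff_eq_sum_atoms {ω₂ : ℝ} (hω : 0 < ω₂) {N : ℕ} (hN : 2 ≤ N) :
    ∃ c s : Fin (N - 1) → ℝ, (∀ k, 0 ≤ c k) ∧ (∀ k, 0 ≤ s k) ∧
      ∀ γ : ℝ, 0 < γ → fluxCoeff ω₂ γ N = γ * ∑ k, c k / (γ ^ 2 + s k ^ 2) := by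
  have hn : 0 < N - 1 := by omega
  have hP := jacobi_posSemidef (N - 1)
  have ha0 : ∀ k, 0 ≤ hP.1.eigenvalues k := fun k => hP.eigenvalues_nonneg k
  refine ⟨fun k => (⇑(hP.1.eigenvectorBasis k) ⬝ᵥ indL) ^ 2 / (2 * (ω₂ + hP.1.eigenvalues k)),
    fun k => Real.sqrt (hP.1.eigenvalues k / (ω₂ + hP.1.eigenvalues k)),
    fun k => by have := ha0 k; positivity, fun k => Real.sqrt_nonneg _, fun γ hγ => ?_⟩
  have hl := lamb_pos hω hγ
  have hr := rootR_pos hω hγ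
  have hsol := jacobi_resolvent_solution hω hγ hn
  have hne : ∀ k, lamb ω₂ γ + hP.1.eigenvalues k ≠ 0 := fun k =>
    (add_pos_of_pos_of_nonneg hl (ha0 k)).ne'
  have hres := dotProduct_resolvent_eq_sum hP.1 hsol hne
  rw [indL_dotProduct hn] at hres
  simp only [useq, pow_zero, mul_one] at hres
  -- `hres : r * (1 + r^(2n-1)) / (1 + r^(2n+1)) = ∑ …`
  have e1 : 2 * (N - 1) + 1 = 2 * N - 1 := by omega
  have e2 : rootR ω₂ γ * (1 + rootR ω₂ γ ^ (2 * (N - 1) - 1)) = rootR ω₂ γ + rootR ω₂ γ ^ (2 * N - 2) := by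
    rw [mul_add, mul_one, ← pow_succ']
    congr 2
    omega
  rw [e1, e2] at hres
  rw [fluxCoeff_eq hω hγ (by omega : 1 < N), hres, Finset.mul_sum, Finset.mul_sum]
  refine Finset.sum_congr rfl fun k _ => ?_
  exact atom_algebra hω hγ (ha0 k) _

/-! ## Registered sub-goal of `stub_harmonicMember` closed by this file -/

/-- **Sub-goal `stub_harmonicMember_atoms`** (spectral half of `stub_harmonicMember`, line `cayley-pencil`): for
`ω₂ > 0`, `N ≥ 2` there are `γ`-free nonnegative atoms `(c_k, s_k)`, `k < N - 1`, with
`fluxCoeff ω₂ γ N = γ ∑_k c_k/(γ² + s_k²)` for every `γ > 0` (`fluxCoeff_eq_sum_atoms`). -/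
theorem stub_harmonicMember_atoms :
    ∀ ω₂ : ℝ, 0 < ω₂ → ∀ N : ℕ, 2 ≤ N → ∃ c s : Fin (N - 1) → ℝ, (∀ k, 0 ≤ c k) ∧ (∀ k, 0 ≤ s k) ∧
      ∀ γ : ℝ, 0 < γ → fluxCoeff ω₂ γ N = γ * ∑ k, c k / (γ ^ 2 + s k ^ 2) :=
  fun _ hω _ hN => fluxCoeff_eq_sum_atoms hω hN

end Summit.AtomisticToContinuum.FouriersLaw.Theorems.ContactStieltjesMeasure.CayleyPencil.HarmonicMember

end
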